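import Summits.ResolutionOfSingularities.ResolutionOfSingularities.Theorems.HilbertSamuelEliminationCampaignW42ToricMarkedTwoRayKernel
import Summits.ResolutionOfSingularities.ResolutionOfSingularities.Theorems.HilbertSamuelEliminationCampaignW42ToricMarkedQStep

/-!
# [OURS · L1 W4.2] Toric marked monomial objects in dimension 3 — brick 9C: the TWO-RAY DISCIPLINE `Q₂` AS A `QDiscipline` TRIPLE

[OURS · L1 W4.2 · seat res-L1-s42-pv-2 gen 6] replaces the role of the «k = 2 exact corner» sub-discipline of the σ-design cell inside
`stub_Wtop_elimination` (CHAIN w42 v3.22 §0u.3 (KR′), planner WORDs (o-KR)/(d-δ) 2026-08-27T16:01:30Z and 16:12:30Z); NOT a statement of the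
manuscript under review ([Hironaka2017] is a CANDIDATE, never a premise), nor of [CossartJannsenSaito2020], [Spivakovsky1983] or [Blanco 2012].
AI work, weaker than expert review.

## What this file is

Packaging only, parallel to res-D-pv-060's `…ToricMarkedQStep` (the three-ray discipline Q): the two-ray kernel of bricks 9A/9B exported FIELD BY
FIELD in the shape of res-D-pv-002's `Sigma.QDiscipline κ m R` (p545446) — allowed moves `Q2AllowedD m d s R` (the dummy-ray clause folded in, so
that only `WF`/`Nonneg` are external premises), ONE measure `q2Measure d s` in the Mathlib linear order `Colex ((ℕ ×ₗ ℕ) →₀ ℕ)` (the count function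
of the multiset `nu` of cone potentials, read colexicographically = the Dershowitz–Manna order on count functions, 060's `Descent.colexCount`;
`WellFoundedLT` is Mathlib's `Finsupp.Colex.wellFoundedLT`, no new instance), the descent `q2Measure_lt_of_q2AllowedD`, the existence
`exists_q2AllowedD_of_not_eresolved`, and the induction principle `q2Induction` («every `Q₂`-disciplined play terminates»).  The `QDiscipline`
instance itself is the one-liner `⟨Q2AllowedD m d, q2Measure d, fun s F hwf hnn h => q2Measure_lt_of_q2AllowedD hm hwf hnn h⟩` on 002's side.

Every `theorem` is fully proved; no `sorry`, no new axiom.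
-/

noncomputable section

set_option linter.dupNamespace false -- mandated namespace of this single-conjunct summit

namespace Summit.ResolutionOfSingularities.ResolutionOfSingularities.Theorems.CampaignW42.Toric

namespace TState

open Finset

variable {ι : Type} [Fintype ι] [Nonempty ι]

/-- **[OURS · L1 W4.2]** The `Q₂`-allowed moves WITH THE DUMMY-RAY CLAUSE folded in: the state is `d`-flat (every cone contains `d`, `a_d ≡ 0`)
and `R` is `Q₂`-allowed (brick 9B).  Preserved shape: only `WF`/`Nonneg` remain external premises, as in `Sigma.QDiscipline`. -/
def Q2AllowedD (m d : ℕ) (s : TState ι) (R : Finset ℕ) : Prop := s.DummyRay d ∧ s.Q2Allowed m d R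

/-- **[OURS · L1 W4.2] THE `Q₂`-MEASURE** of a state off the ray `d`: the count function of the multiset `nu` of cone potentials
`lex(pair width, Σβ)`, in the colexicographic order (a Mathlib linear order, well founded). -/
def q2Measure (d : ℕ) (s : TState ι) : Colex ((ℕ ×ₗ ℕ) →₀ ℕ) := Descent.colexCount (s.nu d)

omit [Fintype ι] [Nonempty ι] in
/-- An allowed move is legal. -/
theorem Q2AllowedD.legal {m d : ℕ} {s : TState ι} {R : Finset ℕ} (h : s.Q2AllowedD m d R) : s.Legal m R := h.2.legal

omit [Fintype ι] [Nonempty ι] in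
/-- An allowed move avoids the dummy ray. -/
theorem Q2AllowedD.not_mem {m d : ℕ} {s : TState ι} {R : Finset ℕ} (h : s.Q2AllowedD m d R) : d ∉ R := h.2.not_mem

omit [Fintype ι] [Nonempty ι] in
/-- **The dummy-ray clause propagates**: after an allowed move the state is again `d`-flat (so allowed-ness can be re-tested at the next state
from `WF`/`Nonneg` alone). -/
theorem Q2AllowedD.dummyRay_move {m d : ℕ} {s : TState ι} {R : Finset ℕ} (h : s.Q2AllowedD m d R) (hwf : s.WF) :
    (s.move m R).DummyRay d :=
  h.1.move hwf h.2.legal.1 h.2.not_mem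

/-- **DESCENT — THE `Q₂`-MEASURE DROPS AT EVERY ALLOWED MOVE** of a well-formed non-negative state (brick 9B `nu_dm_of_q2Allowed`, read on count
functions by 060's `Descent.colexCount_lt_of_dm`).  This is the field `lt_of_qAllowed` of `Sigma.QDiscipline`. -/
theorem q2Measure_lt_of_q2AllowedD {m d : ℕ} (hm : 0 < m) {s : TState ι} (hwf : s.WF) (hnn : s.Nonneg) {R : Finset ℕ}
    (h : s.Q2AllowedD m d R) : (s.move m R).q2Measure d < s.q2Measure d :=
  Descent.colexCount_lt_of_dm (nu_dm_of_q2Allowed hm hwf hnn h.1 h.2)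

omit [Fintype ι] [Nonempty ι] in
/-- **AN ALLOWED MOVE EXISTS as long as a `d`-flat state is not E-resolved.** -/
theorem exists_q2AllowedD_of_not_eresolved {m d : ℕ} {s : TState ι} (hwf : s.WF) (hd : s.DummyRay d) (hE : ¬ s.EResolved m) :
    ∃ R, s.Q2AllowedD m d R := by
  obtain ⟨R, hR⟩ := exists_q2Allowed hwf hd (exists_not_resolved_of_not_eresolved hE)
  exact ⟨R, hd, hR⟩

omit [Fintype ι] [Nonempty ι] in
/-- **Dichotomy form**: a `d`-flat state is E-resolved, or a `Q₂`-allowed move exists. -/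
theorem eresolved_or_exists_q2AllowedD {m d : ℕ} {s : TState ι} (hwf : s.WF) (hd : s.DummyRay d) :
    s.EResolved m ∨ ∃ R, s.Q2AllowedD m d R := by
  by_cases hE : s.EResolved m
  · exact Or.inl hE
  · exact Or.inr (exists_q2AllowedD_of_not_eresolved hwf hd hE)

/-- **EVERY `Q₂`-DISCIPLINED PLAY TERMINATES — induction form**: a property of well-formed non-negative states that holds whenever it holds after
every allowed move holds everywhere (well-founded induction on the `Q₂`-measure; the dummy-ray clause rides inside `Q2AllowedD`). -/
theorem q2Induction {m d : ℕ} (hm : 0 < m) {P : TState ι → Prop}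
    (step : ∀ s : TState ι, s.WF → s.Nonneg → (∀ R, s.Q2AllowedD m d R → P (s.move m R)) → P s)
    (s : TState ι) (hwf : s.WF) (hnn : s.Nonneg) : P s := by
  suffices H : ∀ (q : Colex ((ℕ ×ₗ ℕ) →₀ ℕ)) (s : TState ι), s.q2Measure d = q → s.WF → s.Nonneg → P s from H _ s rfl hwf hnn
  intro q
  induction q using WellFoundedLT.induction with
  | _ q ih =>
    intro s hsq hwf hnn
    exact step s hwf hnn fun R hR =>
      ih _ (hsq ▸ q2Measure_lt_of_q2AllowedD hm hwf hnn hR) _ rfl (hwf.move R) (hnn.move hR.legal)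

/-- **Consistency with the kernel theorem.**  The induction form re-proves E-resolvability of every well-formed non-negative `d`-flat state by the
two-ray discipline (brick 9B `eresolvable_avoiding`, here via `q2Induction`). -/
theorem eresolvableAvoiding_of_q2Induction {m d : ℕ} (hm : 0 < m) (s : TState ι) (hwf : s.WF) (hnn : s.Nonneg) (hd : s.DummyRay d) :
    s.EResolvableAvoiding m d := by
  revert hd
  refine q2Induction (m := m) (d := d) hm (P := fun s => s.DummyRay d → s.EResolvableAvoiding m d) ?_ s hwf hnn
  intro s hwf hnn ih hd
  rcases eresolved_or_exists_q2AllowedD (m := m) hwf hd with hE | ⟨R, hR⟩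
  · exact ⟨s, PlayAvoid.refl s, hE⟩
  · obtain ⟨t, hplay, ht⟩ := ih R hR (hR.dummyRay_move hwf)
    exact ⟨t, PlayAvoid.step R hR.legal hR.not_mem hplay, ht⟩

end TState

end Summit.ResolutionOfSingularities.ResolutionOfSingularities.Theorems.CampaignW42.Toric

end
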